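import Literature.MathematicalPhysics.QuantumFieldTheory.Balaban1983to89.B15Prop1Carrier
import Literature.MathematicalPhysics.QuantumFieldTheory.Balaban1983to89.T4AxialGaugeSmallField

/-!
# `Balaban1983to89.B15Prop1RelativeAxialGauge` — T. Bałaban, *Large field renormalization. I. The basic step of the 𝐑
# operation*, Commun. Math. Phys. **122** (1989) 175–202 [Balaban1989LargeFieldI] = «[IV]», **Proposition 1** p. 194, the function
# (1.77) *"on orbits of this group"*; proof in *Large field renormalization. II*, Commun. Math. Phys. **122** (1989) 355–392
# [Balaban1989LargeFieldII] = «[LF-II]» pp. 358–359: THE RELATIVE AXIAL GAUGE `G₀` ON THE Λ-ORBITS OF (1.77) — p. 359 l. 5–6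
# *"Fixing the gauge G₀ for V′ we get a small configuration, and we can write V′ = exp iB′"* with print's own example of `G₀`,
# p. 358 *"if in this domain Λ we fix an axial gauge in the direction of x₁-axis, i.e., we put B′((x − e₁, x)) = 0 for x ∈ Λ"* —
# PROVED AT THE GROUP LEVEL over the carrier of record `B15Prop1Carrier` (`orbit`, `IsGaugeOn`, `extSet`, `domReg`)

statement-level skeleton of published theorems with citation tags; proofs where landed; nothing here is a claim about
the Yang–Mills mass gap

PDFs held: `paper:balaban1989-cmp122-large-field-i` (journal page = PDF page + 174; p. 194 = PDF 20, text layer `p0020.txt`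
re-read by this seat 2026-08-26) and `paper:balaban1989-cmp122-large-field-ii` (journal page = PDF page + 354; pp. 357–359 =
PDF 3–5, text layers `p0003.txt`–`p0005.txt` re-read by this seat 2026-08-26).

CITATION HEADER / WHAT IS REPRODUCED (mega-formalization `lit-balaban`, HOME `run/shared/lean/pub/lit-balaban/`; seat
`lit-balaban-type-B15` generation 2 = the R141 (B) literature TYPER of DAG node N12; SKELETON row served **B15.Prop1** (head
unchanged); the located junction is dictionary item **(c2)** of `B15Prop1CarrierOnFromModel.prop1Printed_lfVarOn_of_model`
(dag-n12-c, p457808) — *«every configuration of `extSet V_k ∩ dom` lies on the orbit of some chart point (gauge fixing +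
smallness)»* — whose GROUP-LEVEL half is proved here; the chart half (the logarithm `V′ = exp iB′`, `|B′| ≲ |V′ − 1|`) stays the
located letter (ℓ1) of `B15Prop1ChartDeviation`).

THE PRINT.  [IV] p. 194 [PDF 20], verbatim: *"Consider the function V_k↾_Λ → A(U_{k,Z}(V_k)). (1.77) It is defined on
configurations V_k satisfying mild regularity conditions, e.g., |∂V_k − 1| < a₁ on Z. The function is invariant with respect to
the group of all gauge transformations defined on Λ, hence it is natural to consider it on orbits of this group."*  [LF-II]
p. 359 [PDF 5], verbatim: *"For simplicity of the argument let us use the fact that V_k … has an extension from Z ∩ Λᶜ onto Z,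
such that U_{k,Z}(V_k) satisfies the inequality in (1.75) [IV]. We fix such an extension, and we consider the variational problem
for the function V′↾_Λ → A(U_{k,Z}(V′V_k)), where V′ satisfies mild regularity conditions. Fixing the gauge G₀ for V′ we get a
small configuration, and we can write V′ = exp iB′."*  [LF-II] p. 358 [PDF 4], verbatim: *"Consider the quadratic form ‖∂B′‖²
on the fields B′ defined on Λ, and equal to 0 on bonds of the graph G₀. Using the fact that Λ is a rectangular parallelepiped
contained in a cube of the size 100M, and that G₀ determines the axial gauge in Λ, we obtain the inequality (1.8) … The
inequality is also much more general, holding for general domains Λ, and graphs G₀ fixing a gauge in Λ, but with different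
constants. For example, if in this domain Λ we fix an axial gauge in the direction of x₁-axis, i.e., we put B′((x − e₁, x)) = 0
for x ∈ Λ, then the inequality (1.8) holds with the constant (100M)³."*  NO PROOF of *"we get a small configuration"* is
printed; the mechanism is that of [Balaban1985RegularSpaces] Lemma 1 p. 79 (the covariant axial gauge (1.19)–(1.24) of a
perturbation `V′ = U V₀⁻¹` relative to a background, kernel-typed for two blocks in `B8Lemma1NonAbelian` §6–§7) and of
[Balaban1985Averaging] pp. 24–25 (the axial gauge `v₀(x) = V(Γ_{y,x})` and the Stokes ladder, kernel-typed in `B7Prop1Explicit` /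
`T4AxialGaugeSmallField`), here run RELATIVE TO A FROZEN CENTRE on a box with its exterior, which is what (1.77) needs: the
variables are `W = V′Ṽ_k` on the bonds MEETING `Λ` (p. 195 *"bonds intersecting ∂Λ belong to 𝔹₀"*), frozen to the extension
`Ṽ_k` elsewhere, and only gauge transformations *"defined on Λ"* act.

THE THEOREM (objects of `B15Prop1Carrier` and `T4AxialGaugeSmallField`; `d ≥ 2`; print's `x₁` = direction index `0`).  Let
`Λ^{(k)} = castSite '' [lo, hi] ⊂ T^{(k)}` be a box with at most `n + 1` sites per direction whose one-layer enlargement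
`[lo − 1, hi + 1]` does not wrap (`n + 2 < sitesPerDir k`); `Ṽ` a configuration (*the centre*: print's fixed extension of `V_k`)
whose plaquettes on the enlarged box are `ε`-small in `dist1`; `W ∈ extSet (bondsOf Λ^{(k)}) Ṽ` (equal to `Ṽ` off the bonds
meeting `Λ^{(k)}`) whose plaquettes there are `a`-small (*"mild regularity conditions"*).  THEN (`exists_mem_orbit_relSmall`)
the Λ-orbit of `W` (`B15Prop1Carrier.orbit`: transformations `= 1` off `Λ^{(k)}`) contains a configuration `U`, again in
`extSet (bondsOf Λ^{(k)}) Ṽ`, with print's gauge condition `G₀` RELATIVE TO `Ṽ` — `U = Ṽ` on every `x₁`-bond `⟨x − e₁, x⟩`,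
`x ∈ Λ` — and `dist1 (U(b)·Ṽ(b)⁻¹) ≤ (n + 2)(n + d)(a + ε)` on EVERY bond `b` meeting `Λ^{(k)}` (interior AND boundary bonds);
`exists_mem_orbit_relSmall_of_domReg` says the same with the regularity read from the domain `domReg Z k a₁` of the carrier of
record and a centre regular inside `Z^{(k)}`, for `Λ`'s enlarged box inside `Z^{(k)}`.

THE PROOF (folklore lattice gauge theory; §1–§6 on `ℤ^d` over `B7Prop1Explicit.hol` / `axialFn`, §7 transport by
`T4AxialGaugeSmallField.castSite` / `pull`, §8 the knit).  Root the comb at the OUTER corner `y = lo − 1` of the enlarged box and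
let `Â`, `Ĉ` be the axial gauge functions (`B7Prop1Explicit.axialFn`, B7 p. 24) of `W` and of the centre; put `u := Ĉ⁻¹Â` ON the
box and `u := 1` off it.  (§3) The tree contour `Γ_{y,z}` first moves at `x₁ = lo₁ − 1`, outside the box, where `W = Ṽ`, then
along `x₁`; hence `Â(z) = Ĉ(z)` unless `z` lies in the far `x₁`-column above the box (`axialFn_eq_of_exterior`), and in general
`Ĉ(z)⁻¹Â(z)` is the relative transporter of one straight `x₁`-segment (`axialFn_factor`).  (§4–§5) On the far column that
relative transporter is controlled by a LADDER in the direction `x₂` (this is where `d ≥ 2` enters): moving the segment by `e₂`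
costs the two ladder loops (`T4AxialGaugeSmallField.dist1_hol_ladder_le_local`, `≤ (n + 2)·a` and `≤ (n + 2)·ε`) because the end
rungs lie on the faces `x₁ = lo₁ − 1`, `x₁ = hi₁ + 1` where `W = Ṽ` (`dist1_seg_ratio_step`), and at `x₂ = lo₂ − 1` the whole
segment is exterior (`dist1_seg_ratio_le`, `dist1_axialFn_ratio_le_far`: `≤ (n + 1)(n + 2)(a + ε)`).  (§6) For a bond `b` of the
enlarged box, `R(b) = (W^u)(b)·Ṽ(b)⁻¹` is conjugate to `W^{Â}(b)·(Ṽ^{Ĉ}(b))⁻¹` (both ends in the box, or entering the box), to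
that times `Â(b₊)Ĉ(b₊)⁻¹` (leaving the box), or equal to `1` (exterior); the axial bond bounds
`T4AxialGaugeSmallField.dist1_axial_bond_le_uniform` (`≤ (d − 1)(n + 2)·a`, resp. `·ε`) and the far-column bound add up to
`(n + 2)(n + d)(a + ε)`; on `x₁`-bonds ending in the box both axial bond variables are EXACTLY `1`
(`B8Lemma1NonAbelian.axial_treeBond_eq_one`), so `R = 1` there — print's `G₀` (`exists_relGauge_zd`).  (§7) The cut-off lift
to the torus is a transformation *defined on* `Λ^{(k)}` by construction; non-wrapping of the enlarged box makes `castSite`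
injective where `u` is read (`exists_isGaugeOn_relSmall`).

HONEST SCOPE.  (i) GROUP LEVEL ONLY: the conclusion is `dist1 (U·Ṽ⁻¹) ≤ …` bondwise; writing `U·Ṽ⁻¹ = exp iB′` with `B′` small
in a norm is the exponential chart's Lipschitz property (dictionary item (ℓ1), `B15Prop1ChartDeviation`), not touched here.
(ii) `d ≥ 2` IS NECESSARY for the statement: for `d = 1` the transporter of `W` straight through `Λ` is invariant under the
gauge transformations defined on `Λ` and need not be close to that of `Ṽ` (noted, not typed).  (iii) Print's `Λ` *"is a
rectangular parallelepiped contained in a cube of the size 100M"* ([LF-II] p. 358): boxes only; the constant `(n + 2)(n + d)` is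
what the comb + one ladder give and is not optimised (print states no constant for *"small"*).  (iv) The regularity
hypotheses are on the plaquettes of the ENLARGED box `[lo − 1, hi + 1]` (one layer around `Λ`), inside print's `Z ⊃ Λ` where
*"|∂V_k − 1| < a₁ on Z"*; `Setup.PlaqSmallOn` is strict, the conclusions are `≤`.  (v) Every declaration is a theorem proved from
Mathlib and the two imports (`B7Prop1Explicit`, `B8Lemma1NonAbelian`, `T4AxialGaugeSmallField`, `B11GaugeGlue`,
`B15Prop1Carrier` used BY NAME); no definition, no `… : Prop` fact, no `sorry`, no `instance`, no `notation`; folklore lattice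
gauge fixing — nothing of Bałaban is asserted; count-neutral; NOT a discharge of N12, NOT summit progress, nothing continuum /
OS / mass gap / Clay.
-/

noncomputable section

open Set

namespace Literature.MathematicalPhysics.QuantumFieldTheory.Balaban1983to89.B15Prop1RelativeAxialGauge

open B7Prop1Explicit (Letter e e_apply disp disp_nil disp_cons disp_append hol hol_nil hol_cons hol_append stepHol stepHol_true
  seg seg_natCast seg_zero mem_seg disp_seg treeWord disp_treeWord plaqWord lplaqWord lplaqWord_true ladder hol_ladder axialFn)
open B8Lemma1NonAbelian (lowPart lowPart_apply e_nonneg forward_of_mem_treeWord disp_nonneg_of_forward axial_treeBond_eq_one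
  pairwise_gt_finRange_reverse)
open T4AxialGaugeSmallField (BoxPlaqSmall dist1_hol_ladder_le_local dist1_axial_bond_le_uniform)
open B11GaugeGlue (dist1_conj_inv)

/-! ## §1 `ℤ^d` bookkeeping: forward words, where they run, when two configurations have the same transporter -/

section Words

variable {d : ℕ} {G : Type*} [Group G]

/-- Two configurations agreeing on every bond variable a FORWARD word reads have the same parallel transporter along it
(induction on the word; the letter at position `x + disp w₁` reads the bond `⟨x + disp w₁, l.1⟩`). [folklore] -/
private theorem hol_congr_forward (W V : (Fin d → ℤ) → Fin d → G) :
    ∀ (w : List (Letter d)) (x : Fin d → ℤ), (∀ l ∈ w, l = (l.1, true)) →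
      (∀ (w₁ w₂ : List (Letter d)) (l : Letter d), w = w₁ ++ l :: w₂ → W (x + disp w₁) l.1 = V (x + disp w₁) l.1) →
      hol W x w = hol V x w
  | [], _, _, _ => by simp
  | l :: w, x, hfw, hag => by
    have hl : l = (l.1, true) := hfw l (by simp)
    rw [hol_cons, hol_cons]
    have h0 : W x l.1 = V x l.1 := by simpa using hag [] w l rfl
    have hs : stepHol W x l = stepHol V x l := by
      rw [hl, stepHol_true, stepHol_true]; exact h0
    rw [hs, hol_congr_forward W V w (x + l.vec) (fun l' hl' => hfw l' (List.mem_cons_of_mem l hl'))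
      (fun w₁ w₂ l' h => by
        have := hag (l :: w₁) w₂ l' (by rw [h]; rfl)
        rwa [disp_cons, ← add_assoc] at this)]

/-- If no letter of `w` points in the direction `κ₀`, the displacement of `w` has `κ₀`-coordinate `0`. [folklore] -/
private theorem disp_apply_eq_zero_of_forall_ne {κ₀ : Fin d} :
    ∀ {w : List (Letter d)}, (∀ l ∈ w, l.1 ≠ κ₀) → disp w κ₀ = 0
  | [], _ => by simp
  | l :: w, h => by
    have hl : l.1 ≠ κ₀ := h l (by simp)
    rw [disp_cons, Pi.add_apply, disp_apply_eq_zero_of_forall_ne (fun l' hl' => h l' (List.mem_cons_of_mem l hl')), add_zero]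
    obtain ⟨μ, b⟩ := l
    cases b <;> simp [Letter.vec, e_apply, Ne.symm hl]

/-- Prefixes of forward words: `0 ≤ disp w₁ ≤ disp (w₁ ++ w₂)`. [folklore] -/
private theorem disp_prefix_le {w₁ w₂ : List (Letter d)} (h : ∀ l ∈ w₁ ++ w₂, l = (l.1, true)) :
    (0 : Fin d → ℤ) ≤ disp w₁ ∧ disp w₁ ≤ disp (w₁ ++ w₂) := by
  refine ⟨disp_nonneg_of_forward fun l hl => h l (List.mem_append_left w₂ hl), ?_⟩
  rw [disp_append]
  exact le_add_of_nonneg_right (disp_nonneg_of_forward fun l hl => h l (List.mem_append_right w₁ hl))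

/-- THE TREE CONTOUR ENDS WITH ITS `x₁`-SEGMENT: `Γ_{y,y+v}` = (the segments in the directions `d, …, 2`, none of them an
`e₁`-letter) followed by the straight segment `seg e₁ (v₁)` (print's `x₁` = index `0`). [folklore] -/
private theorem treeWord_eq_append_seg (h0 : 0 < d) (v : Fin d → ℤ) :
    ∃ K : List (Fin d), (∀ κ ∈ K, κ ≠ ⟨0, h0⟩) ∧
      treeWord v = (K.flatMap fun κ => seg κ (v κ)) ++ seg ⟨0, h0⟩ (v ⟨0, h0⟩) := by
  set i0 : Fin d := ⟨0, h0⟩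
  obtain ⟨s, t, hst⟩ := List.append_of_mem (a := i0) (l := (List.finRange d).reverse) (by simp)
  have hpw := pairwise_gt_finRange_reverse d
  rw [hst, List.pairwise_append] at hpw
  obtain ⟨-, hp2, hp3⟩ := hpw
  have ht : t = [] := by
    rw [List.eq_nil_iff_forall_not_mem]
    intro b hb
    have : b < i0 := (List.pairwise_cons.mp hp2).1 b hb
    exact Nat.not_lt_zero _ (Fin.lt_def.mp this)
  refine ⟨s, fun κ hκ => ?_, ?_⟩
  · exact ne_of_gt (hp3 κ hκ i0 (by simp))
  · rw [treeWord, hst, ht, List.flatMap_append, List.flatMap_cons, List.flatMap_nil, List.append_nil]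

end Words

/-! ## §2–§3 The tree contour from the outer corner: exterior contours read the centre -/

section Exterior

variable {d : ℕ} {G : Type*} [Group G]

/-- Positions along a forward word: for `w = A ++ l :: B` the letter `l` is read at displacement `disp A` with `0 ≤ disp A` and
`disp A + e_{l} ≤ disp w`. [folklore] -/
private theorem disp_bounds_of_forward {w A B : List (Letter d)} {l : Letter d} (hfw : ∀ l' ∈ w, l' = (l'.1, true))
    (h : w = A ++ l :: B) : (0 : Fin d → ℤ) ≤ disp A ∧ disp A + e l.1 ≤ disp w := by
  have hfw' : ∀ l' ∈ (A ++ [l]) ++ B, l' = (l'.1, true) := by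
    intro l' hl'; refine hfw l' ?_; rw [h]; simpa using hl'
  have hl : l = (l.1, true) := hfw' l (by simp)
  have h1 := disp_prefix_le hfw'
  have h2 : disp (A ++ [l]) = disp A + e l.1 := by rw [disp_append, hl]; simp
  have h3 : (A ++ [l]) ++ B = w := by rw [h]; simp
  rw [h3, h2] at h1
  exact ⟨(disp_prefix_le (w₁ := A) (w₂ := [l] ++ B) (by simpa using hfw')).1, h1.2⟩

/-- A straight `x₁`-segment of the enlarged box whose transverse position has a coordinate outside `[lo, hi]` reads only bonds
not meeting `[lo, hi]`; two configurations agreeing there have the same transporter along it. [cite: Balaban1985Averaging, (8)–(9) pp.18–19] -/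
theorem hol_seg_eq_of_exterior (h0 : 0 < d) (W V : (Fin d → ℤ) → Fin d → G) {lo hi : Fin d → ℤ}
    (hag : ∀ (p : Fin d → ℤ) (μ : Fin d), lo - 1 ≤ p → p + e μ ≤ hi + 1 →
      ¬ (lo ≤ p ∧ p ≤ hi) → ¬ (lo ≤ p + e μ ∧ p + e μ ≤ hi) → W p μ = V p μ)
    {p : Fin d → ℤ} {m : ℕ} (hp : lo - 1 ≤ p) (hpm : p + (m : ℤ) • e ⟨0, h0⟩ ≤ hi + 1)
    (hout : ∃ κ : Fin d, κ ≠ ⟨0, h0⟩ ∧ (p κ < lo κ ∨ hi κ < p κ)) :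
    hol W p (seg ⟨0, h0⟩ m) = hol V p (seg ⟨0, h0⟩ m) := by
  set i0 : Fin d := ⟨0, h0⟩ with hi0
  obtain ⟨κ, hκ, hκout⟩ := hout
  have hfw : ∀ l ∈ seg i0 (m : ℤ), l = (l.1, true) := by
    intro l hl; rw [seg_natCast, List.mem_replicate] at hl; rw [hl.2]
  refine hol_congr_forward W V _ p hfw ?_
  intro w₁ w₂ l hw
  obtain ⟨hA0, hA1⟩ := disp_bounds_of_forward hfw hw
  rw [disp_seg] at hA1
  have hl0 : l.1 = i0 := mem_seg (show l ∈ seg i0 (m : ℤ) by rw [hw]; simp)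
  have hw₁ : ∀ l' ∈ w₁, l'.1 ≠ κ := fun l' hl' => by
    rw [mem_seg (show l' ∈ seg i0 (m : ℤ) by rw [hw]; exact List.mem_append_left _ hl')]; exact hκ.symm
  have hcκ : (p + disp w₁) κ = p κ := by
    rw [Pi.add_apply, disp_apply_eq_zero_of_forall_ne hw₁, add_zero]
  have hcκ' : (p + disp w₁ + e l.1) κ = p κ := by
    rw [Pi.add_apply, hcκ, hl0, e_apply, if_neg hκ, add_zero]
  have hout' : ¬ (lo κ ≤ p κ ∧ p κ ≤ hi κ) := by rintro ⟨h1, h2⟩; rcases hκout with h | h <;> linarith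
  refine hag _ _ (hp.trans (le_add_of_nonneg_right hA0)) ?_ ?_ ?_
  · calc p + disp w₁ + e l.1 = p + (disp w₁ + e l.1) := add_assoc _ _ _
      _ ≤ p + (m : ℤ) • e i0 := add_le_add (le_refl p) hA1
      _ ≤ hi + 1 := hpm
  · rintro ⟨h1, h2⟩; exact hout' ⟨by simpa [hcκ] using h1 κ, by simpa [hcκ] using h2 κ⟩
  · rintro ⟨h1, h2⟩; exact hout' ⟨by simpa [hcκ'] using h1 κ, by simpa [hcκ'] using h2 κ⟩

/-- **THE TREE CONTOUR FROM THE OUTER CORNER, FACTORED.**  For `z` in the enlarged box `[lo − 1, hi + 1]` the axial gauge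
functions of `W` and `V` rooted at `lo − 1` factor through a COMMON prefix value `g` (the segments in the directions `d, …, 2`
run at `x₁ = lo₁ − 1`, outside `[lo, hi]`, where `W = V`) followed by the straight `x₁`-segment `seg e₁ m` from the point `p` of
the face `x₁ = lo₁ − 1` below `z`. [cite: Balaban1985Averaging, p.24 (axial gauge); Balaban1989LargeFieldII, p.358 (axial gauge in the x₁-direction)] -/
theorem axialFn_factor (h0 : 0 < d) (W V : (Fin d → ℤ) → Fin d → G) {lo hi : Fin d → ℤ}
    (hag : ∀ (p : Fin d → ℤ) (μ : Fin d), lo - 1 ≤ p → p + e μ ≤ hi + 1 →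
      ¬ (lo ≤ p ∧ p ≤ hi) → ¬ (lo ≤ p + e μ ∧ p + e μ ≤ hi) → W p μ = V p μ)
    {z : Fin d → ℤ} (hz : lo - 1 ≤ z) (hz' : z ≤ hi + 1) :
    ∃ (g : G) (p : Fin d → ℤ) (m : ℕ), p ⟨0, h0⟩ = lo ⟨0, h0⟩ - 1 ∧ (∀ κ, κ ≠ ⟨0, h0⟩ → p κ = z κ) ∧ lo - 1 ≤ p ∧
      p + (m : ℤ) • e ⟨0, h0⟩ = z ∧
      axialFn W (lo - 1) z = g * hol W p (seg ⟨0, h0⟩ m) ∧ axialFn V (lo - 1) z = g * hol V p (seg ⟨0, h0⟩ m) := by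
  set y : Fin d → ℤ := lo - 1 with hy
  set v : Fin d → ℤ := z - y with hv
  have hv0 : 0 ≤ v := sub_nonneg.2 hz
  have hyv : y + v = z := by rw [hv, add_sub_cancel]
  have hyap : ∀ κ, y κ = lo κ - 1 := fun κ => by simp [hy]
  obtain ⟨K, hK, hsplit⟩ := treeWord_eq_append_seg h0 v
  set i0 : Fin d := ⟨0, h0⟩ with hi0
  set P := K.flatMap fun κ => seg κ (v κ) with hP
  have hfw : ∀ l ∈ treeWord v, l = (l.1, true) := fun l hl => forward_of_mem_treeWord hv0 hl
  have hPdir : ∀ l ∈ P, l.1 ≠ i0 := by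
    intro l hl
    obtain ⟨κ, hκ, hlκ⟩ := List.mem_flatMap.1 hl
    rw [mem_seg hlκ]; exact hK κ hκ
  have hdispP : ∀ κ, κ ≠ i0 → disp P κ = v κ := by
    intro κ hκ
    have h1 := disp_treeWord v
    rw [hsplit, disp_append, disp_seg] at h1
    have h2 := congr_fun h1 κ
    simp only [Pi.add_apply, Pi.smul_apply, e_apply, smul_eq_mul] at h2
    rw [if_neg hκ, mul_zero, add_zero] at h2
    exact h2
  have hdispP0 : disp P i0 = 0 := disp_apply_eq_zero_of_forall_ne hPdir
  obtain ⟨m, hm⟩ := Int.eq_ofNat_of_zero_le (hv0 i0)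
  -- the common prefix
  have hprefix : hol W y P = hol V y P := by
    refine hol_congr_forward W V P y (fun l hl => hfw l (by rw [hsplit]; exact List.mem_append_left _ hl)) ?_
    intro w₁ w₂ l hw
    have hdec : treeWord v = w₁ ++ l :: (w₂ ++ seg i0 (v i0)) := by rw [hsplit, hw]; simp
    obtain ⟨hA0, hA1⟩ := disp_bounds_of_forward hfw hdec
    rw [disp_treeWord] at hA1
    have hl0 : l.1 ≠ i0 := hPdir l (by rw [hw]; simp)
    have hw₁ : ∀ l' ∈ w₁, l'.1 ≠ i0 := fun l' hl' => hPdir l' (by rw [hw]; exact List.mem_append_left _ hl')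
    have hc0 : (y + disp w₁) i0 = lo i0 - 1 := by
      rw [Pi.add_apply, disp_apply_eq_zero_of_forall_ne hw₁, add_zero, hyap]
    have hc0' : (y + disp w₁ + e l.1) i0 = lo i0 - 1 := by
      rw [Pi.add_apply, hc0, e_apply, if_neg (Ne.symm hl0), add_zero]
    refine hag _ _ (le_add_of_nonneg_right hA0) ?_ ?_ ?_
    · calc y + disp w₁ + e l.1 = y + (disp w₁ + e l.1) := add_assoc _ _ _
        _ ≤ y + v := add_le_add (le_refl y) hA1
        _ = z := hyv
        _ ≤ hi + 1 := hz'
    · rintro ⟨h1, -⟩; have := h1 i0; rw [hc0] at this; linarith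
    · rintro ⟨h1, -⟩; have := h1 i0; rw [hc0'] at this; linarith
  refine ⟨hol W y P, y + disp P, m, ?_, ?_, ?_, ?_, ?_, ?_⟩
  · rw [Pi.add_apply, hdispP0, add_zero, hyap]
  · intro κ hκ; rw [Pi.add_apply, hdispP κ hκ, ← hyv, Pi.add_apply]
  · exact le_add_of_nonneg_right
      ((disp_prefix_le (w₁ := P) (w₂ := seg i0 (v i0)) (fun l hl => hfw l (by rw [hsplit]; exact hl))).1)
  · have h1 := disp_treeWord v
    rw [hsplit, disp_append, disp_seg, hm] at h1
    rw [add_assoc, h1, hyv]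
  · show hol W y (treeWord (z - y)) = _
    rw [← hv, hsplit, hol_append, hm]
  · show hol V y (treeWord (z - y)) = _
    rw [← hv, hsplit, hol_append, hm, hprefix]

/-- **EXTERIOR CONTOURS READ THE CENTRE.**  If `W = V` on the bonds of the enlarged box not meeting `[lo, hi]`, the axial
gauge functions of `W` and `V` rooted at `lo − 1` COINCIDE at every point `z` of the enlarged box off the far `x₁`-column:
some coordinate `κ ≠ 1` of `z` outside `[lo_κ, hi_κ]`, or `z₁ = lo₁ − 1` (print's `x₁` = index `0`). [cite: Balaban1985Averaging, p.24 (axial gauge); Balaban1989LargeFieldII, p.359 l.5–6] -/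
theorem axialFn_eq_of_exterior (h0 : 0 < d) (W V : (Fin d → ℤ) → Fin d → G) {lo hi : Fin d → ℤ}
    (hag : ∀ (p : Fin d → ℤ) (μ : Fin d), lo - 1 ≤ p → p + e μ ≤ hi + 1 →
      ¬ (lo ≤ p ∧ p ≤ hi) → ¬ (lo ≤ p + e μ ∧ p + e μ ≤ hi) → W p μ = V p μ)
    {z : Fin d → ℤ} (hz : lo - 1 ≤ z) (hz' : z ≤ hi + 1)
    (hout : (∃ κ : Fin d, κ ≠ ⟨0, h0⟩ ∧ (z κ < lo κ ∨ hi κ < z κ)) ∨ z ⟨0, h0⟩ = lo ⟨0, h0⟩ - 1) :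
    axialFn W (lo - 1) z = axialFn V (lo - 1) z := by
  obtain ⟨g, p, m, hp0, hpκ, hp, hpm, hW, hV⟩ := axialFn_factor h0 W V hag hz hz'
  rw [hW, hV]
  rcases hout with ⟨κ, hκ, hκout⟩ | h00
  · rw [hol_seg_eq_of_exterior h0 W V hag hp (hpm.le.trans hz') ⟨κ, hκ, by rw [hpκ κ hκ]; exact hκout⟩]
  · have hm0 : m = 0 := by
      have h1 : (p + (m : ℤ) • e (⟨0, h0⟩ : Fin d)) ⟨0, h0⟩ = p ⟨0, h0⟩ + m := by simp [e_apply]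
      rw [hpm, h00, hp0] at h1
      omega
    simp [hm0]

end Exterior

/-! ## §4 The far `x₁`-column: one ladder in the direction `x₂` (`d ≥ 2`) -/

section FarColumn

variable {d : ℕ} {G : Type*} [GaugeGroup G]

open B8Lemma1NonAbelian (zsmul_e_apply e_apply_self e_apply_of_ne)

/-- The ladder loop over a straight `x₁`-segment of `m` bonds, rungs in the direction `x₂`, inside the enlarged box: `dist1 ≤ m·α`
under the box plaquette hypothesis (`T4AxialGaugeSmallField.dist1_hol_ladder_le_local`). [cite: Balaban1985Averaging, pp.24–25 (ladder estimate)] -/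
theorem dist1_hol_ladder_seg_le (h0 : 0 < d) (h1 : 1 < d) (X : (Fin d → ℤ) → Fin d → G) {lo hi : Fin d → ℤ} {α : ℝ}
    (hX : BoxPlaqSmall X (lo - 1) (hi + 1) α) {p : Fin d → ℤ} {m : ℕ} (hp : lo - 1 ≤ p)
    (hpm : p + (m : ℤ) • e ⟨0, h0⟩ + e ⟨1, h1⟩ ≤ hi + 1) :
    dist1 (hol X p (ladder (seg ⟨0, h0⟩ m) ⟨1, h1⟩)) ≤ m * α := by
  have h01 : (⟨0, h0⟩ : Fin d) ≠ ⟨1, h1⟩ := fun h => by simp [Fin.ext_iff] at h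
  have hfw : ∀ l ∈ seg (⟨0, h0⟩ : Fin d) (m : ℤ), l = (l.1, true) := by
    intro l hl; rw [seg_natCast, List.mem_replicate] at hl; rw [hl.2]
  have hlen : (seg (⟨0, h0⟩ : Fin d) (m : ℤ)).length = m := by rw [B7Prop1Explicit.length_seg]; simp
  have h := dist1_hol_ladder_le_local X ⟨1, h1⟩ (α := α) (seg ⟨0, h0⟩ (m : ℤ)) p
    (fun l hl => by rw [mem_seg hl]; exact h01) ?_
  · rw [hlen] at h; exact h
  intro w₁ w₂ l hw
  obtain ⟨hA0, hA1⟩ := disp_bounds_of_forward hfw hw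
  rw [disp_seg] at hA1
  have hl : l = (⟨0, h0⟩, true) := by
    have hl1 : l.1 = ⟨0, h0⟩ := mem_seg (show l ∈ seg (⟨0, h0⟩ : Fin d) (m : ℤ) by rw [hw]; simp)
    rw [hfw l (by rw [hw]; simp), hl1]
  rw [hl, lplaqWord_true]
  refine hX _ _ _ h01 (hp.trans (le_add_of_nonneg_right hA0)) ?_
  calc p + disp w₁ + e ⟨0, h0⟩ + e ⟨1, h1⟩ = p + (disp w₁ + e l.1) + e ⟨1, h1⟩ := by rw [hl, add_assoc p]
    _ ≤ p + (m : ℤ) • e ⟨0, h0⟩ + e ⟨1, h1⟩ := by gcongr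
    _ ≤ hi + 1 := hpm

/-- ONE RUNG OF THE FAR-COLUMN COMPARISON.  For the straight `x₁`-segment `σ` through the box from the face `x₁ = lo₁ − 1` to
the face `x₁ = hi₁ + 1`: shifting its transverse position by `e₂` changes the relative transporter `V(σ)⁻¹ W(σ)` by at most
the two ladder loops (`≤ m·ε + m·a` in `dist1`), because the two end rungs lie on the faces, where `W = V`. [cite: Balaban1985RegularSpaces, Lemma 1 p.79 (mechanism); Balaban1989LargeFieldII, p.359 l.5–6] -/
theorem dist1_seg_ratio_step (h0 : 0 < d) (h1 : 1 < d) (W V : (Fin d → ℤ) → Fin d → G) {lo hi : Fin d → ℤ} {a ε : ℝ}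
    (hag : ∀ (p : Fin d → ℤ) (μ : Fin d), lo - 1 ≤ p → p + e μ ≤ hi + 1 →
      ¬ (lo ≤ p ∧ p ≤ hi) → ¬ (lo ≤ p + e μ ∧ p + e μ ≤ hi) → W p μ = V p μ)
    (hW : BoxPlaqSmall W (lo - 1) (hi + 1) a) (hV : BoxPlaqSmall V (lo - 1) (hi + 1) ε)
    {p : Fin d → ℤ} {m : ℕ} (hp0 : p ⟨0, h0⟩ = lo ⟨0, h0⟩ - 1) (hm : p ⟨0, h0⟩ + m = hi ⟨0, h0⟩ + 1)
    (hp : lo - 1 ≤ p) (hpm : p + (m : ℤ) • e ⟨0, h0⟩ + e ⟨1, h1⟩ ≤ hi + 1) :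
    dist1 ((hol V (p + e ⟨1, h1⟩) (seg ⟨0, h0⟩ m))⁻¹ * hol W (p + e ⟨1, h1⟩) (seg ⟨0, h0⟩ m)) ≤
      dist1 ((hol V p (seg ⟨0, h0⟩ m))⁻¹ * hol W p (seg ⟨0, h0⟩ m)) + (m * ε + m * a) := by
  set i0 : Fin d := ⟨0, h0⟩ with hi0
  set i1 : Fin d := ⟨1, h1⟩ with hi1
  set σ := seg i0 (m : ℤ) with hσ
  have h01 : i0 ≠ i1 := fun h => by simp [hi0, hi1, Fin.ext_iff] at h
  have hm0 : (0 : Fin d → ℤ) ≤ (m : ℤ) • e i0 := B8Lemma1NonAbelian.zsmul_e_nonneg (by positivity) i0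
  have hp' : p + e i1 ≤ hi + 1 := by
    calc p + e i1 ≤ p + (m : ℤ) • e i0 + e i1 := by gcongr; exact le_add_of_nonneg_right hm0
      _ ≤ hi + 1 := hpm
  -- the ladder identity solved for the shifted segment
  have key : ∀ X : (Fin d → ℤ) → Fin d → G,
      hol X (p + e i1) σ = (X p i1)⁻¹ * (hol X p (ladder σ i1))⁻¹ * hol X p σ * X (p + disp σ) i1 := by
    intro X; rw [hol_ladder X p σ i1]; group
  -- the two end rungs are exterior bonds
  have hE1 : W p i1 = V p i1 := by
    refine hag p i1 hp hp' ?_ ?_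
    · rintro ⟨h, -⟩; have := h i0; rw [hp0] at this; linarith
    · rintro ⟨h, -⟩; have := h i0
      rw [Pi.add_apply, hp0, e_apply_of_ne h01] at this; linarith
  have hE2 : W (p + disp σ) i1 = V (p + disp σ) i1 := by
    rw [hσ, disp_seg]
    refine hag _ i1 (hp.trans (le_add_of_nonneg_right hm0)) hpm ?_ ?_
    · rintro ⟨-, h⟩; have := h i0
      rw [Pi.add_apply, zsmul_e_apply, if_pos rfl] at this; push_cast at this; linarith
    · rintro ⟨-, h⟩; have := h i0
      rw [Pi.add_apply, Pi.add_apply, zsmul_e_apply, if_pos rfl, e_apply_of_ne h01] at this; push_cast at this; linarith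
  rw [key W, key V, hE1, hE2]
  set SW := hol W p σ
  set SV := hol V p σ
  set LW := hol W p (ladder σ i1)
  set LV := hol V p (ladder σ i1)
  set E1 := V p i1
  set E2 := V (p + disp σ) i1
  have halg : (E1⁻¹ * LV⁻¹ * SV * E2)⁻¹ * (E1⁻¹ * LW⁻¹ * SW * E2) =
      E2⁻¹ * ((SV⁻¹ * (LV * LW⁻¹) * SV) * (SV⁻¹ * SW)) * E2 := by group
  rw [halg, dist1_conj_inv]
  have hLW : dist1 LW ≤ m * a := dist1_hol_ladder_seg_le h0 h1 W hW hp hpm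
  have hLV : dist1 LV ≤ m * ε := dist1_hol_ladder_seg_le h0 h1 V hV hp hpm
  calc dist1 (SV⁻¹ * (LV * LW⁻¹) * SV * (SV⁻¹ * SW))
      ≤ dist1 (SV⁻¹ * (LV * LW⁻¹) * SV) + dist1 (SV⁻¹ * SW) := GaugeGroup.dist1_mul_le _ _
    _ = dist1 (LV * LW⁻¹) + dist1 (SV⁻¹ * SW) := by rw [dist1_conj_inv]
    _ ≤ dist1 LV + dist1 LW⁻¹ + dist1 (SV⁻¹ * SW) := by gcongr; exact GaugeGroup.dist1_mul_le _ _
    _ = dist1 LV + dist1 LW + dist1 (SV⁻¹ * SW) := by rw [GaugeGroup.dist1_inv]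
    _ ≤ m * ε + m * a + dist1 (SV⁻¹ * SW) := by gcongr
    _ = dist1 (SV⁻¹ * SW) + (m * ε + m * a) := by ring

/-- THE FAR COLUMN, by induction along `x₂` from the face `x₂ = lo₂ − 1` (where the whole segment is exterior and the relative
transporter is `1`): after `t` rungs `dist1 (V(σ)⁻¹ W(σ)) ≤ t·m·(ε + a)`. [cite: Balaban1985RegularSpaces, Lemma 1 p.79 (mechanism); Balaban1989LargeFieldII, p.359 l.5–6] -/
theorem dist1_seg_ratio_le (h0 : 0 < d) (h1 : 1 < d) (W V : (Fin d → ℤ) → Fin d → G) {lo hi : Fin d → ℤ} {a ε : ℝ}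
    (hag : ∀ (p : Fin d → ℤ) (μ : Fin d), lo - 1 ≤ p → p + e μ ≤ hi + 1 →
      ¬ (lo ≤ p ∧ p ≤ hi) → ¬ (lo ≤ p + e μ ∧ p + e μ ≤ hi) → W p μ = V p μ)
    (hW : BoxPlaqSmall W (lo - 1) (hi + 1) a) (hV : BoxPlaqSmall V (lo - 1) (hi + 1) ε)
    {p : Fin d → ℤ} {m : ℕ} (hp0 : p ⟨0, h0⟩ = lo ⟨0, h0⟩ - 1) (hp1 : p ⟨1, h1⟩ = lo ⟨1, h1⟩ - 1)
    (hm : p ⟨0, h0⟩ + m = hi ⟨0, h0⟩ + 1) (hp : lo - 1 ≤ p) (hpm : p + (m : ℤ) • e ⟨0, h0⟩ ≤ hi + 1) :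
    ∀ t : ℕ, (t : ℤ) ≤ hi ⟨1, h1⟩ - lo ⟨1, h1⟩ + 1 →
      dist1 ((hol V (p + (t : ℤ) • e ⟨1, h1⟩) (seg ⟨0, h0⟩ m))⁻¹ * hol W (p + (t : ℤ) • e ⟨1, h1⟩) (seg ⟨0, h0⟩ m)) ≤
        t * (m * ε + m * a) := by
  have h01 : (⟨0, h0⟩ : Fin d) ≠ ⟨1, h1⟩ := fun h => by simp [Fin.ext_iff] at h
  intro t
  induction t with
  | zero =>
    intro _
    simp only [Nat.cast_zero, zero_smul, add_zero, zero_mul]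
    rw [hol_seg_eq_of_exterior h0 W V hag hp hpm ⟨⟨1, h1⟩, h01.symm, Or.inl (by rw [hp1]; linarith)⟩, inv_mul_cancel,
      GaugeGroup.dist1_one]
  | succ t ih =>
    intro ht
    have ht' : (t : ℤ) ≤ hi ⟨1, h1⟩ - lo ⟨1, h1⟩ + 1 := by push_cast at ht; linarith
    have ih' := ih ht'
    set q : Fin d → ℤ := p + (t : ℤ) • e ⟨1, h1⟩ with hq
    have hq_succ : p + ((t + 1 : ℕ) : ℤ) • e ⟨1, h1⟩ = q + e ⟨1, h1⟩ := by
      rw [hq, add_assoc, ← add_one_zsmul]; push_cast; rfl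
    rw [hq_succ]
    have hq0 : q ⟨0, h0⟩ = lo ⟨0, h0⟩ - 1 := by rw [hq, Pi.add_apply, zsmul_e_apply, if_neg h01, add_zero, hp0]
    have hqm : q ⟨0, h0⟩ + m = hi ⟨0, h0⟩ + 1 := by rw [hq0, ← hp0, hm]
    have hqlo : lo - 1 ≤ q := hp.trans (le_add_of_nonneg_right (B8Lemma1NonAbelian.zsmul_e_nonneg (by positivity) _))
    have hqm' : q + (m : ℤ) • e ⟨0, h0⟩ + e ⟨1, h1⟩ ≤ hi + 1 := by
      intro κ
      have hκm := hpm κ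
      simp only [Pi.add_apply, zsmul_e_apply, hq] at hκm ⊢
      by_cases hκ1 : κ = ⟨1, h1⟩
      · subst hκ1
        rw [if_neg (Ne.symm h01), e_apply_self, hp1]
        simp only [if_true, Pi.one_apply]
        push_cast at ht ⊢; linarith
      · rw [if_neg hκ1, e_apply_of_ne hκ1]
        simpa using hκm
    calc _ ≤ dist1 ((hol V q (seg ⟨0, h0⟩ m))⁻¹ * hol W q (seg ⟨0, h0⟩ m)) + (m * ε + m * a) :=
          dist1_seg_ratio_step h0 h1 W V hag hW hV hq0 hqm hqlo hqm'
      _ ≤ t * (m * ε + m * a) + (m * ε + m * a) := by gcongr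
      _ = ((t + 1 : ℕ) : ℝ) * (m * ε + m * a) := by push_cast; ring

end FarColumn

/-! ## §5 The far `x₁`-column, packaged -/

section FarPackaged

variable {d : ℕ} {G : Type*} [GaugeGroup G]

open B8Lemma1NonAbelian (zsmul_e_apply e_apply_self e_apply_of_ne zsmul_e_nonneg)

/-- **THE FAR `x₁`-COLUMN.**  At a point `z` of the far face `x₁ = hi₁ + 1` of the enlarged box whose transverse coordinates lie
in `[lo, hi]`, the axial gauge functions of `W` and of the centre `V` (rooted at `lo − 1`) differ by the relative transporter
of the `x₁`-segment through the box below `z`, hence (`dist1_seg_ratio_le`, at most `n + 1` rungs of length `≤ n + 2`) by at most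
`(n + 1)(n + 2)(ε + a)` in `dist1` — the only place where `d ≥ 2` is used. [cite: Balaban1985RegularSpaces, Lemma 1 p.79 (mechanism); Balaban1989LargeFieldII, p.359 l.5–6] -/
theorem dist1_axialFn_ratio_le_far (h0 : 0 < d) (h1 : 1 < d) (W V : (Fin d → ℤ) → Fin d → G) {lo hi : Fin d → ℤ}
    {a ε : ℝ} (ha : 0 ≤ a) (hε : 0 ≤ ε)
    (hag : ∀ (p : Fin d → ℤ) (μ : Fin d), lo - 1 ≤ p → p + e μ ≤ hi + 1 →
      ¬ (lo ≤ p ∧ p ≤ hi) → ¬ (lo ≤ p + e μ ∧ p + e μ ≤ hi) → W p μ = V p μ)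
    (hW : BoxPlaqSmall W (lo - 1) (hi + 1) a) (hV : BoxPlaqSmall V (lo - 1) (hi + 1) ε)
    {n : ℕ} (hn : ∀ κ, hi κ ≤ lo κ + n) (hlo0 : lo ⟨0, h0⟩ ≤ hi ⟨0, h0⟩)
    {z : Fin d → ℤ} (hz0 : z ⟨0, h0⟩ = hi ⟨0, h0⟩ + 1) (hzt : ∀ κ, κ ≠ ⟨0, h0⟩ → lo κ ≤ z κ ∧ z κ ≤ hi κ) :
    dist1 ((axialFn V (lo - 1) z)⁻¹ * axialFn W (lo - 1) z) ≤ ((n : ℝ) + 1) * (((n : ℝ) + 2) * ε + ((n : ℝ) + 2) * a) := by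
  have h01 : (⟨0, h0⟩ : Fin d) ≠ ⟨1, h1⟩ := fun h => by simp [Fin.ext_iff] at h
  have hz : lo - 1 ≤ z := fun κ => by
    by_cases hκ : κ = ⟨0, h0⟩
    · subst hκ; simp only [Pi.sub_apply, Pi.one_apply, hz0]; linarith
    · simp only [Pi.sub_apply, Pi.one_apply]; linarith [(hzt κ hκ).1]
  have hz' : z ≤ hi + 1 := fun κ => by
    by_cases hκ : κ = ⟨0, h0⟩
    · subst hκ; simp only [Pi.add_apply, Pi.one_apply, hz0]; exact le_rfl
    · simp only [Pi.add_apply, Pi.one_apply]; linarith [(hzt κ hκ).2]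
  obtain ⟨g, p, m, hp0, hpκ, hp, hpm, hWf, hVf⟩ := axialFn_factor h0 W V hag hz hz'
  rw [hWf, hVf, mul_inv_rev, mul_assoc, inv_mul_cancel_left]
  -- the length `m` of the segment and the number `T` of rungs
  have hm : p ⟨0, h0⟩ + m = hi ⟨0, h0⟩ + 1 := by
    have := congr_fun hpm ⟨0, h0⟩
    rw [Pi.add_apply, zsmul_e_apply, if_pos rfl] at this; rw [this, hz0]
  have hmle : (m : ℝ) ≤ (n : ℝ) + 2 := by
    have h2 := hn ⟨0, h0⟩
    have : (m : ℤ) ≤ n + 2 := by rw [hp0] at hm; linarith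
    exact_mod_cast this
  obtain ⟨hz1lo, hz1hi⟩ := hzt ⟨1, h1⟩ h01.symm
  obtain ⟨T, hT⟩ := Int.eq_ofNat_of_zero_le (show (0 : ℤ) ≤ z ⟨1, h1⟩ - lo ⟨1, h1⟩ + 1 by linarith)
  have hTle : (T : ℝ) ≤ (n : ℝ) + 1 := by
    have h2 := hn ⟨1, h1⟩
    have : (T : ℤ) ≤ n + 1 := by rw [← hT]; linarith
    exact_mod_cast this
  have hp1 : p ⟨1, h1⟩ = z ⟨1, h1⟩ := hpκ _ h01.symm
  -- the base point `p*` of the column on the face `x₂ = lo₂ − 1`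
  set ps : Fin d → ℤ := p - (T : ℤ) • e ⟨1, h1⟩ with hps
  have hpps : p = ps + (T : ℤ) • e ⟨1, h1⟩ := by rw [hps, sub_add_cancel]
  have hps0 : ps ⟨0, h0⟩ = lo ⟨0, h0⟩ - 1 := by
    rw [hps, Pi.sub_apply, zsmul_e_apply, if_neg h01, sub_zero, hp0]
  have hps1 : ps ⟨1, h1⟩ = lo ⟨1, h1⟩ - 1 := by
    rw [hps, Pi.sub_apply, zsmul_e_apply, if_pos rfl, hp1, ← hT]; ring
  have hpsm : ps ⟨0, h0⟩ + m = hi ⟨0, h0⟩ + 1 := by rw [hps0, ← hp0, hm]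
  have hpslo : lo - 1 ≤ ps := fun κ => by
    have hpk := hp κ
    simp only [hps, Pi.sub_apply, Pi.one_apply, zsmul_e_apply] at hpk ⊢
    by_cases hκ : κ = ⟨1, h1⟩
    · subst hκ; rw [if_pos rfl, hp1, ← hT]; linarith
    · rw [if_neg hκ, sub_zero]; exact hpk
  have hpsm' : ps + (m : ℤ) • e ⟨0, h0⟩ ≤ hi + 1 := fun κ => by
    have hκm := (hpm.le.trans hz') κ
    simp only [hps, Pi.add_apply, Pi.sub_apply, Pi.one_apply, zsmul_e_apply] at hκm ⊢
    by_cases hκ : κ = ⟨1, h1⟩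
    · subst hκ; rw [if_pos rfl, if_neg (Ne.symm h01), hp1, ← hT]; linarith
    · rw [if_neg hκ, sub_zero]; exact hκm
  have hmain := dist1_seg_ratio_le h0 h1 W V hag hW hV hps0 hps1 hpsm hpslo hpsm' T (by rw [← hT]; linarith)
  rw [← hpps] at hmain
  refine hmain.trans ?_
  have hm0 : (0 : ℝ) ≤ m := Nat.cast_nonneg m
  calc (T : ℝ) * (m * ε + m * a) ≤ ((n : ℝ) + 1) * (m * ε + m * a) := by gcongr
    _ ≤ ((n : ℝ) + 1) * (((n : ℝ) + 2) * ε + ((n : ℝ) + 2) * a) := by gcongr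

end FarPackaged

/-! ## §6 The relative axial gauge on `ℤ^d`: `R = W^u Ṽ⁻¹` is `1` on `G₀` and small on every bond of the enlarged box -/

section RelativeGaugeZd

variable {d : ℕ} {G : Type*} [GaugeGroup G]

open B8Lemma1NonAbelian (zsmul_e_apply e_apply_self e_apply_of_ne zsmul_e_nonneg)

/-- Every `x₁`-bond is a tree bond of the comb (no coordinate lies below the first one). [folklore] -/
private theorem lowPart_dir0 (h0 : 0 < d) (v : Fin d → ℤ) : lowPart ⟨0, h0⟩ v = 0 := by
  funext κ
  simp only [lowPart_apply, Pi.zero_apply, ite_eq_right_iff]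
  intro h
  exact absurd (Fin.lt_def.mp h) (Nat.not_lt_zero _)

/-- Leaving the box through a bond: if `x ∈ [lo, hi]` and `x + e_μ ∉ [lo, hi]` then `x + e_μ` lies on the far `μ`-face of the
enlarged box and its other coordinates stay in range. [folklore] -/
private theorem exit_coords {lo hi x : Fin d → ℤ} {μ : Fin d} (hb : lo ≤ x ∧ x ≤ hi) (hb' : ¬ (lo ≤ x + e μ ∧ x + e μ ≤ hi)) :
    (x + e μ) μ = hi μ + 1 ∧ ∀ κ, κ ≠ μ → lo κ ≤ (x + e μ) κ ∧ (x + e μ) κ ≤ hi κ := by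
  have hlo : lo ≤ x + e μ := hb.1.trans (le_add_of_nonneg_right (e_nonneg μ))
  have hne : ¬ (x + e μ ≤ hi) := fun h => hb' ⟨hlo, h⟩
  obtain ⟨κ₀, hκ₀⟩ := not_forall.mp hne
  have hκ₀μ : κ₀ = μ := by
    by_contra h
    exact hκ₀ (by rw [Pi.add_apply, e_apply_of_ne h, add_zero]; exact hb.2 κ₀)
  subst hκ₀μ
  have h1 := hb.2 κ₀
  rw [Pi.add_apply, e_apply_self] at hκ₀ ⊢
  refine ⟨by have := not_le.mp hκ₀; linarith, fun κ hκ => ?_⟩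
  rw [Pi.add_apply, e_apply_of_ne hκ, add_zero]
  exact ⟨hb.1 κ, hb.2 κ⟩

/-- Entering the box through a bond: if `x ∉ [lo, hi]` and `x + e_μ ∈ [lo, hi]` then `x_μ = lo_μ − 1`. [folklore] -/
private theorem enter_coord {lo hi x : Fin d → ℤ} {μ : Fin d} (hb : ¬ (lo ≤ x ∧ x ≤ hi)) (hb' : lo ≤ x + e μ ∧ x + e μ ≤ hi) :
    x μ = lo μ - 1 := by
  have hhi : x ≤ hi := (le_add_of_nonneg_right (e_nonneg μ)).trans hb'.2
  have hne : ¬ (lo ≤ x) := fun h => hb ⟨h, hhi⟩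
  obtain ⟨κ₀, hκ₀⟩ := not_forall.mp hne
  have hκ₀μ : κ₀ = μ := by
    by_contra h
    have := hb'.1 κ₀
    rw [Pi.add_apply, e_apply_of_ne h, add_zero] at this
    exact hκ₀ this
  subst hκ₀μ
  have h1 := hb'.1 κ₀
  rw [Pi.add_apply, e_apply_self] at h1
  have := not_le.mp hκ₀
  linarith

/-- **THE RELATIVE AXIAL GAUGE ON `ℤ^d` (group level of [LF-II] p. 359 l. 5–6 with the gauge `G₀` of p. 358).**  `d ≥ 2`; a box
`[lo, hi]` of at most `n + 1` sites per direction; a centre `V` and a configuration `W` equal to `V` on the bonds of the enlarged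
box `[lo − 1, hi + 1]` not meeting `[lo, hi]`; plaquettes of the enlarged box `a`-small for `W` and `ε`-small for `V` (in
`dist1`).  Then there is a gauge transformation `u`, EQUAL TO `1` OFF THE BOX, such that the relative configuration
`R = W^u · V⁻¹` is `1` on print's `G₀` — every `x₁`-bond ENDING in the box — and on the exterior bonds, and satisfies
`dist1 (R(b)) ≤ (n + 2)(n + d)(a + ε)` on EVERY bond of the enlarged box, in particular on every bond meeting the box (interior
and boundary).  `u = Ĉ⁻¹Â` on the box, `Â`, `Ĉ` the axial gauge functions of `W`, `V` rooted at the outer corner `lo − 1`.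
[cite: Balaban1989LargeFieldII, pp.358–359 (G₀; «we get a small configuration»); Balaban1985RegularSpaces, Lemma 1 (1.19)–(1.24) p.79] -/
theorem exists_relGauge_zd (h0 : 0 < d) (h1 : 1 < d) (W V : (Fin d → ℤ) → Fin d → G) {lo hi : Fin d → ℤ} {a ε : ℝ}
    (ha : 0 ≤ a) (hε : 0 ≤ ε)
    (hag : ∀ (p : Fin d → ℤ) (μ : Fin d), lo - 1 ≤ p → p + e μ ≤ hi + 1 →
      ¬ (lo ≤ p ∧ p ≤ hi) → ¬ (lo ≤ p + e μ ∧ p + e μ ≤ hi) → W p μ = V p μ)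
    (hW : BoxPlaqSmall W (lo - 1) (hi + 1) a) (hV : BoxPlaqSmall V (lo - 1) (hi + 1) ε)
    {n : ℕ} (hn : ∀ κ, hi κ ≤ lo κ + n) :
    ∃ u : (Fin d → ℤ) → G,
      (∀ x, ¬ (lo ≤ x ∧ x ≤ hi) → u x = 1) ∧
      (∀ x, lo - 1 ≤ x → (lo ≤ x + e ⟨0, h0⟩ ∧ x + e ⟨0, h0⟩ ≤ hi) →
        B7Prop1Explicit.gaugeAct u W x ⟨0, h0⟩ = V x ⟨0, h0⟩) ∧
      (∀ x μ, lo - 1 ≤ x → x + e μ ≤ hi + 1 → ¬ (lo ≤ x ∧ x ≤ hi) → ¬ (lo ≤ x + e μ ∧ x + e μ ≤ hi) →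
        B7Prop1Explicit.gaugeAct u W x μ = V x μ) ∧
      (∀ x μ, lo - 1 ≤ x → x + e μ ≤ hi + 1 →
        dist1 (B7Prop1Explicit.gaugeAct u W x μ * (V x μ)⁻¹) ≤ ((n : ℝ) + 2) * ((n : ℝ) + d) * (a + ε)) := by
  classical
  set A := axialFn W (lo - 1) with hA
  set C := axialFn V (lo - 1) with hC
  let u : (Fin d → ℤ) → G := fun x => if lo ≤ x ∧ x ≤ hi then (C x)⁻¹ * A x else 1
  have hu_in : ∀ {x}, (lo ≤ x ∧ x ≤ hi) → u x = (C x)⁻¹ * A x := fun hx => if_pos hx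
  have hu_out : ∀ {x}, ¬ (lo ≤ x ∧ x ≤ hi) → u x = 1 := fun hx => if_neg hx
  -- the uniform axial bounds on the enlarged box, rooted at `lo − 1`
  have hn' : ∀ κ, (hi + 1) κ ≤ (lo - 1) κ + ((n + 2 : ℕ) : ℤ) := fun κ => by
    have := hn κ; simp only [Pi.add_apply, Pi.sub_apply, Pi.one_apply]; push_cast; linarith
  have hgW : ∀ {x μ}, lo - 1 ≤ x → x + e μ ≤ hi + 1 →
      dist1 (B7Prop1Explicit.gaugeAct A W x μ) ≤ ((d - 1 : ℕ) : ℝ) * ((n + 2 : ℕ) : ℝ) * a :=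
    fun hx hxμ => dist1_axial_bond_le_uniform W hW ha hn' _ _ hx hxμ
  have hgV : ∀ {x μ}, lo - 1 ≤ x → x + e μ ≤ hi + 1 →
      dist1 (B7Prop1Explicit.gaugeAct C V x μ) ≤ ((d - 1 : ℕ) : ℝ) * ((n + 2 : ℕ) : ℝ) * ε :=
    fun hx hxμ => dist1_axial_bond_le_uniform V hV hε hn' _ _ hx hxμ
  -- the three algebraic forms of `R(b) = W^u(b) V(b)⁻¹`
  have idA : ∀ {x μ}, (lo ≤ x ∧ x ≤ hi) → (lo ≤ x + e μ ∧ x + e μ ≤ hi) →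
      B7Prop1Explicit.gaugeAct u W x μ * (V x μ)⁻¹ =
        (C x)⁻¹ * (B7Prop1Explicit.gaugeAct A W x μ * (B7Prop1Explicit.gaugeAct C V x μ)⁻¹) * C x := by
    intro x μ hb hb'
    simp only [B7Prop1Explicit.gaugeAct, hu_in hb, hu_in hb']; group
  have idB : ∀ {x μ}, (lo ≤ x ∧ x ≤ hi) → ¬ (lo ≤ x + e μ ∧ x + e μ ≤ hi) →
      B7Prop1Explicit.gaugeAct u W x μ * (V x μ)⁻¹ =
        (C x)⁻¹ * (B7Prop1Explicit.gaugeAct A W x μ * (A (x + e μ) * (C (x + e μ))⁻¹) *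
          (B7Prop1Explicit.gaugeAct C V x μ)⁻¹) * C x := by
    intro x μ hb hb'
    simp only [B7Prop1Explicit.gaugeAct, hu_in hb, hu_out hb']; group
  have idC : ∀ {x μ}, ¬ (lo ≤ x ∧ x ≤ hi) → (lo ≤ x + e μ ∧ x + e μ ≤ hi) →
      B7Prop1Explicit.gaugeAct u W x μ * (V x μ)⁻¹ =
        (A x)⁻¹ * (B7Prop1Explicit.gaugeAct A W x μ * (B7Prop1Explicit.gaugeAct C V x μ)⁻¹) * C x := by
    intro x μ hb hb'
    simp only [B7Prop1Explicit.gaugeAct, hu_out hb, hu_in hb']; group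
  -- entering bonds start outside the far column: `Â = Ĉ` there
  have hAC_enter : ∀ {x μ}, lo - 1 ≤ x → x + e μ ≤ hi + 1 → ¬ (lo ≤ x ∧ x ≤ hi) → (lo ≤ x + e μ ∧ x + e μ ≤ hi) →
      A x = C x := by
    intro x μ hx hxμ hb hb'
    have hxμ' : x ≤ hi + 1 := (le_add_of_nonneg_right (e_nonneg μ)).trans hxμ
    have hcoord := enter_coord hb hb'
    refine axialFn_eq_of_exterior h0 W V hag hx hxμ' ?_
    by_cases hμ : μ = ⟨0, h0⟩
    · subst hμ; exact Or.inr hcoord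
    · exact Or.inl ⟨μ, hμ, Or.inl (by rw [hcoord]; linarith)⟩
  -- the constants
  have hd1 : ((d - 1 : ℕ) : ℝ) = (d : ℝ) - 1 := by rw [Nat.cast_sub (by omega : 1 ≤ d)]; simp
  have hK : ((d - 1 : ℕ) : ℝ) * ((n + 2 : ℕ) : ℝ) * a + ((d - 1 : ℕ) : ℝ) * ((n + 2 : ℕ) : ℝ) * ε +
      ((n : ℝ) + 1) * (((n : ℝ) + 2) * ε + ((n : ℝ) + 2) * a) = ((n : ℝ) + 2) * ((n : ℝ) + d) * (a + ε) := by
    rw [hd1]; push_cast; ring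
  have hfar0 : 0 ≤ ((n : ℝ) + 1) * (((n : ℝ) + 2) * ε + ((n : ℝ) + 2) * a) := by positivity
  have hT0 : 0 ≤ ((n : ℝ) + 2) * ((n : ℝ) + d) * (a + ε) := by positivity
  -- the interior-type estimate `dist1 (h⁻¹ (gW gV⁻¹) h) ≤ K₁ a + K₁ ε`
  have hAtype : ∀ {x μ} (h : G), lo - 1 ≤ x → x + e μ ≤ hi + 1 →
      dist1 (h⁻¹ * (B7Prop1Explicit.gaugeAct A W x μ * (B7Prop1Explicit.gaugeAct C V x μ)⁻¹) * h) ≤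
        ((n : ℝ) + 2) * ((n : ℝ) + d) * (a + ε) := by
    intro x μ h hx hxμ
    rw [dist1_conj_inv]
    calc _ ≤ dist1 (B7Prop1Explicit.gaugeAct A W x μ) + dist1 (B7Prop1Explicit.gaugeAct C V x μ)⁻¹ :=
          GaugeGroup.dist1_mul_le _ _
      _ = dist1 (B7Prop1Explicit.gaugeAct A W x μ) + dist1 (B7Prop1Explicit.gaugeAct C V x μ) := by
          rw [GaugeGroup.dist1_inv]
      _ ≤ ((d - 1 : ℕ) : ℝ) * ((n + 2 : ℕ) : ℝ) * a + ((d - 1 : ℕ) : ℝ) * ((n + 2 : ℕ) : ℝ) * ε :=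
          add_le_add (hgW hx hxμ) (hgV hx hxμ)
      _ ≤ _ := by rw [← hK]; linarith
  refine ⟨u, fun x hx => hu_out hx, ?_, ?_, ?_⟩
  · -- `G₀`: the `x₁`-bonds ending in the box carry `R = 1`
    intro x hx hb'
    have hxμ : x + e ⟨0, h0⟩ ≤ hi + 1 := hb'.2.trans (le_add_of_nonneg_right (fun _ => zero_le_one))
    have gW1 : B7Prop1Explicit.gaugeAct A W x ⟨0, h0⟩ = 1 := axial_treeBond_eq_one W (lo - 1) x ⟨0, h0⟩ (lowPart_dir0 h0 _)
    have gV1 : B7Prop1Explicit.gaugeAct C V x ⟨0, h0⟩ = 1 := axial_treeBond_eq_one V (lo - 1) x ⟨0, h0⟩ (lowPart_dir0 h0 _)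
    rw [← mul_inv_eq_one]
    by_cases hb : lo ≤ x ∧ x ≤ hi
    · rw [idA hb hb', gW1, gV1]; group
    · rw [idC hb hb', gW1, gV1, hAC_enter hx hxμ hb hb']; group
  · -- exterior bonds of the enlarged box
    intro x μ hx hxμ hb hb'
    simp only [B7Prop1Explicit.gaugeAct, hu_out hb, hu_out hb', one_mul, inv_one, mul_one]
    exact hag x μ hx hxμ hb hb'
  · -- the bound on every bond of the enlarged box
    intro x μ hx hxμ
    by_cases hb : lo ≤ x ∧ x ≤ hi <;> by_cases hb' : lo ≤ x + e μ ∧ x + e μ ≤ hi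
    · rw [idA hb hb']; exact hAtype _ hx hxμ
    · rw [idB hb hb', dist1_conj_inv]
      obtain ⟨hfar, htrans⟩ := exit_coords hb hb'
      have hmid : dist1 (A (x + e μ) * (C (x + e μ))⁻¹) ≤ ((n : ℝ) + 1) * (((n : ℝ) + 2) * ε + ((n : ℝ) + 2) * a) := by
        by_cases hμ : μ = ⟨0, h0⟩
        · subst hμ
          have hconj : A (x + e ⟨0, h0⟩) * (C (x + e ⟨0, h0⟩))⁻¹ =
              C (x + e ⟨0, h0⟩) * ((C (x + e ⟨0, h0⟩))⁻¹ * A (x + e ⟨0, h0⟩)) * (C (x + e ⟨0, h0⟩))⁻¹ := by group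
          rw [hconj, GaugeGroup.dist1_conj]
          exact dist1_axialFn_ratio_le_far h0 h1 W V ha hε hag hW hV hn ((hb.1 _).trans (hb.2 _)) hfar htrans
        · have hx' : lo - 1 ≤ x + e μ := (hx.trans (le_add_of_nonneg_right (e_nonneg μ)))
          have hAC : A (x + e μ) = C (x + e μ) :=
            axialFn_eq_of_exterior h0 W V hag hx' hxμ (Or.inl ⟨μ, hμ, Or.inr (by rw [hfar]; linarith)⟩)
          rw [hAC, mul_inv_cancel, GaugeGroup.dist1_one]; exact hfar0
      calc _ ≤ dist1 (B7Prop1Explicit.gaugeAct A W x μ * (A (x + e μ) * (C (x + e μ))⁻¹)) +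
            dist1 (B7Prop1Explicit.gaugeAct C V x μ)⁻¹ := GaugeGroup.dist1_mul_le _ _
        _ ≤ dist1 (B7Prop1Explicit.gaugeAct A W x μ) + dist1 (A (x + e μ) * (C (x + e μ))⁻¹) +
            dist1 (B7Prop1Explicit.gaugeAct C V x μ) := by
            rw [GaugeGroup.dist1_inv]; gcongr; exact GaugeGroup.dist1_mul_le _ _
        _ ≤ ((d - 1 : ℕ) : ℝ) * ((n + 2 : ℕ) : ℝ) * a + ((n : ℝ) + 1) * (((n : ℝ) + 2) * ε + ((n : ℝ) + 2) * a) +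
            ((d - 1 : ℕ) : ℝ) * ((n + 2 : ℕ) : ℝ) * ε := add_le_add (add_le_add (hgW hx hxμ) hmid) (hgV hx hxμ)
        _ = ((n : ℝ) + 2) * ((n : ℝ) + d) * (a + ε) := by rw [← hK]; ring
    · rw [idC hb hb', hAC_enter hx hxμ hb hb']; exact hAtype _ hx hxμ
    · simp only [B7Prop1Explicit.gaugeAct, hu_out hb, hu_out hb', one_mul, inv_one, mul_one]
      rw [hag x μ hx hxμ hb hb', mul_inv_cancel, GaugeGroup.dist1_one]; exact hT0

end RelativeGaugeZd

/-! ## §7 Transport to the torus `T^{(k)}` of `Setup`: the box `Λ^{(k)} = castSite '' [lo, hi]`, the cut-off lift of the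
relative gauge (a transformation DEFINED ON `Λ^{(k)}` in the sense of `B15Prop1Carrier.IsGaugeOn`) -/

section Torus

variable {P : Params} {k : ℕ} {G : Type*} [GaugeGroup G]

open T4AxialGaugeSmallField (castSite castSite_apply castSite_add_e pull pull_apply boxPlaqs boxBonds boxPlaqSmall_pull
  castSite_injOn_box)
open B15DeterminingSets (bondsOf)
open B15Prop1Carrier (IsGaugeOn orbit gaugeAct_mem_orbit extSet mem_extSet_iff domReg mem_domReg_iff plaqsInside)
open B8Lemma1NonAbelian (zsmul_e_apply e_apply_self e_apply_of_ne)
open GaugeField (gaugeAct)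

/-- One lattice step on the torus is injective. [folklore] -/
private theorem shift_inj {s t : Site P k} {μ : Fin P.d} (h : s.shift μ = t.shift μ) : s = t := by
  funext κ
  have hκ := congr_fun h κ
  by_cases hκμ : κ = μ
  · subst hκμ; simpa [Site.shift] using hκ
  · simpa [Site.shift, Function.update_of_ne hκμ] using hκ

/-- `castSite (z − e_μ)` steps to `castSite z`. [folklore] -/
private theorem castSite_sub_e_shift (z : Fin P.d → ℤ) (μ : Fin P.d) : (castSite (z - e μ) : Site P k).shift μ = castSite z := by
  rw [← castSite_add_e, sub_add_cancel]

/-- `e_μ ≤ 1` coordinatewise. [folklore] -/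
private theorem e_le_one {d : ℕ} (μ : Fin d) : e μ ≤ (1 : Fin d → ℤ) := fun κ => by
  simp only [e_apply, Pi.one_apply]; split_ifs <;> norm_num

/-- **THE RELATIVE AXIAL GAUGE ON A BOX OF THE TORUS.**  `d ≥ 2`; `Λ^{(k)} = castSite '' [lo, hi]`, a box of at most `n + 1`
sites per direction whose one-layer enlargement does not wrap (`n + 2 < sitesPerDir k`); a centre `Ṽ` and a configuration `W`
equal to `Ṽ` off the bonds meeting `Λ^{(k)}`; the plaquettes of the enlarged box `a`-small for `W`, `ε`-small for `Ṽ`.  Then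
there is a gauge transformation `u` DEFINED ON `Λ^{(k)}` (`= 1` off it) with: `W^u = Ṽ` off the bonds meeting `Λ^{(k)}`;
`W^u = Ṽ` on print's `G₀` = the `x₁`-bonds `⟨x − e₁, x⟩`, `x ∈ Λ` ([LF-II] p. 358); and
`dist1 (W^u(b) Ṽ(b)⁻¹) ≤ (n + 2)(n + d)(a + ε)` on EVERY bond meeting `Λ^{(k)}` — [LF-II] p. 359 l. 5–6 *«Fixing the gauge G₀
for V′ we get a small configuration»* for `V′ = W^u Ṽ⁻¹`, at the group level.
[cite: Balaban1989LargeFieldII, pp.358–359 (proof of Proposition 1 [IV]); Balaban1989LargeFieldI, (1.77) p.194] -/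
theorem exists_isGaugeOn_relSmall (hd : 2 ≤ P.d) {lo hi : Fin P.d → ℤ} {n : ℕ} (hn : ∀ κ, hi κ ≤ lo κ + n)
    (hN : n + 2 < P.sitesPerDir k) (W Vt : GaugeField P k G) {a ε : ℝ} (ha : 0 ≤ a) (hε : 0 ≤ ε)
    (hW : PlaqSmallOn (boxPlaqs (lo - 1) (hi + 1)) a W) (hV : PlaqSmallOn (boxPlaqs (lo - 1) (hi + 1)) ε Vt)
    (hext : ∀ b, b ∉ bondsOf (castSite '' Icc lo hi : Set (Site P k)) → W b = Vt b) :
    ∃ u : GaugeTransf P k G, IsGaugeOn (castSite '' Icc lo hi) u ∧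
      (∀ b, b ∉ bondsOf (castSite '' Icc lo hi : Set (Site P k)) → gaugeAct u W b = Vt b) ∧
      (∀ μ : Fin P.d, (μ : ℕ) = 0 → ∀ x, x ∈ Icc lo hi →
        gaugeAct u W ⟨castSite (x - e μ), μ⟩ = Vt ⟨castSite (x - e μ), μ⟩) ∧
      (∀ b ∈ bondsOf (castSite '' Icc lo hi : Set (Site P k)),
        dist1 (gaugeAct u W b * (Vt b)⁻¹) ≤ ((n : ℝ) + 2) * ((n : ℝ) + P.d) * (a + ε)) := by
  classical
  have h0 : 0 < P.d := by omega
  have h1 : 1 < P.d := by omega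
  set S : Set (Site P k) := castSite '' Icc lo hi with hS
  -- the enlarged box does not wrap
  have hNW : ∀ κ, (hi + 1) κ - (lo - 1) κ < P.sitesPerDir k := fun κ => by
    have := hn κ; have hN' : ((n + 2 : ℕ) : ℤ) < P.sitesPerDir k := by exact_mod_cast hN
    simp only [Pi.add_apply, Pi.sub_apply, Pi.one_apply]; push_cast at hN'; linarith
  have hinj : ∀ {x x' : Fin P.d → ℤ}, lo - 1 ≤ x → x ≤ hi + 1 → lo - 1 ≤ x' → x' ≤ hi + 1 →
      (castSite x : Site P k) = castSite x' → x = x' :=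
    fun hx hx' hy hy' h => castSite_injOn_box hNW hx hx' hy hy' h
  have hlo1 : lo - 1 ≤ lo := fun κ => by simp
  have hhi1 : hi ≤ hi + 1 := fun κ => by simp
  -- membership in `S` from the enlarged box means membership in the box
  have hmemS : ∀ {x : Fin P.d → ℤ}, lo - 1 ≤ x → x ≤ hi + 1 → ((castSite x : Site P k) ∈ S ↔ (lo ≤ x ∧ x ≤ hi)) := by
    intro x hx hx'
    constructor
    · rintro ⟨x', ⟨h1', h2'⟩, hxx'⟩
      rw [← hinj (hlo1.trans h1') (h2'.trans hhi1) hx hx' hxx']; exact ⟨h1', h2'⟩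
    · intro h; exact ⟨x, h, rfl⟩
  -- the `ℤ^d` hypotheses for the pullbacks
  have hag : ∀ (p : Fin P.d → ℤ) (μ : Fin P.d), lo - 1 ≤ p → p + e μ ≤ hi + 1 →
      ¬ (lo ≤ p ∧ p ≤ hi) → ¬ (lo ≤ p + e μ ∧ p + e μ ≤ hi) → pull W p μ = pull Vt p μ := by
    intro p μ hp hpμ hb hb'
    have hp' : p ≤ hi + 1 := (le_add_of_nonneg_right (e_nonneg μ)).trans hpμ
    have hpμ' : lo - 1 ≤ p + e μ := hp.trans (le_add_of_nonneg_right (e_nonneg μ))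
    refine hext ⟨castSite p, μ⟩ ?_
    rintro (h | h)
    · exact hb ((hmemS hp hp').1 h)
    · rw [PBond.tgt, ← castSite_add_e] at h
      exact hb' ((hmemS hpμ' hpμ).1 h)
  have hWZ : BoxPlaqSmall (pull W) (lo - 1) (hi + 1) a := boxPlaqSmall_pull W subset_rfl hW
  have hVZ : BoxPlaqSmall (pull Vt) (lo - 1) (hi + 1) ε := boxPlaqSmall_pull Vt subset_rfl hV
  obtain ⟨uZ, hu1, hG0, -, hbound⟩ := exists_relGauge_zd h0 h1 (pull W) (pull Vt) ha hε hag hWZ hVZ hn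
  -- the cut-off lift
  let u : GaugeTransf P k G := fun s => if h : ∃ x, x ∈ Icc lo hi ∧ castSite x = s then uZ (Classical.choose h) else 1
  have hIs : IsGaugeOn S u := by
    intro s hs
    have : ¬ ∃ x, x ∈ Icc lo hi ∧ castSite x = s := fun ⟨x, hx, hxs⟩ => hs ⟨x, hx, hxs⟩
    exact dif_neg this
  have hdict : ∀ {x : Fin P.d → ℤ}, lo - 1 ≤ x → x ≤ hi + 1 → u (castSite x) = uZ x := by
    intro x hx hx'
    by_cases h : ∃ x', x' ∈ Icc lo hi ∧ (castSite x' : Site P k) = castSite x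
    · show (if h : ∃ x', x' ∈ Icc lo hi ∧ (castSite x' : Site P k) = castSite x then uZ (Classical.choose h) else 1) = uZ x
      rw [dif_pos h]
      obtain ⟨⟨h1', h2'⟩, hxx'⟩ := Classical.choose_spec h
      rw [hinj (hlo1.trans h1') (h2'.trans hhi1) hx hx' hxx']
    · show (if h : ∃ x', x' ∈ Icc lo hi ∧ (castSite x' : Site P k) = castSite x then uZ (Classical.choose h) else 1) = uZ x
      rw [dif_neg h, hu1 x fun hb => h ⟨x, hb, rfl⟩]
  -- the torus gauge action read on `ℤ^d`
  have hact : ∀ {x : Fin P.d → ℤ} {μ : Fin P.d}, lo - 1 ≤ x → x + e μ ≤ hi + 1 →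
      gaugeAct u W ⟨castSite x, μ⟩ = B7Prop1Explicit.gaugeAct uZ (pull W) x μ := by
    intro x μ hx hxμ
    have hx' : x ≤ hi + 1 := (le_add_of_nonneg_right (e_nonneg μ)).trans hxμ
    have hxμ' : lo - 1 ≤ x + e μ := hx.trans (le_add_of_nonneg_right (e_nonneg μ))
    simp only [GaugeField.gaugeAct, B7Prop1Explicit.gaugeAct, PBond.tgt, pull_apply]
    rw [← castSite_add_e, hdict hx hx', hdict hxμ' hxμ]
  -- every bond meeting `S` is `⟨castSite x, μ⟩` with `x`, `x + e_μ` in the enlarged box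
  have hbond : ∀ {b : PBond P k}, b ∈ bondsOf S →
      ∃ x : Fin P.d → ℤ, lo - 1 ≤ x ∧ x + e b.dir ≤ hi + 1 ∧ b = ⟨castSite x, b.dir⟩ := by
    rintro ⟨s, μ⟩ (⟨x, ⟨h1', h2'⟩, hxs⟩ | ⟨x, ⟨h1', h2'⟩, hxs⟩)
    · exact ⟨x, hlo1.trans h1', add_le_add h2' (e_le_one μ), by simp only at hxs; subst hxs; rfl⟩
    · refine ⟨x - e μ, fun κ => ?_, by rw [sub_add_cancel]; exact h2'.trans hhi1, ?_⟩
      · have := h1' κ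
        simp only [Pi.sub_apply, Pi.one_apply, e_apply]; split_ifs <;> linarith
      · have hs : s = castSite (x - e μ) :=
          shift_inj (by rw [castSite_sub_e_shift]; exact hxs.symm)
        simp [hs]
  refine ⟨u, hIs, ?_, ?_, ?_⟩
  · -- off the bonds meeting `Λ^{(k)}` nothing moves
    intro b hb
    have hsrc : b.src ∉ S := fun h => hb (Or.inl h)
    have htgt : b.tgt ∉ S := fun h => hb (Or.inr h)
    simp only [GaugeField.gaugeAct, hIs _ hsrc, hIs _ htgt, one_mul, inv_one, mul_one]
    exact hext b hb
  · -- `G₀`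
    intro μ hμ x hx
    have hμ0 : μ = ⟨0, h0⟩ := Fin.ext hμ
    subst hμ0
    have hx1 : lo - 1 ≤ x - e ⟨0, h0⟩ := fun κ => by
      have := hx.1 κ
      simp only [Pi.sub_apply, Pi.one_apply, e_apply]; split_ifs <;> linarith
    have hx2 : x - e ⟨0, h0⟩ + e ⟨0, h0⟩ ≤ hi + 1 := by rw [sub_add_cancel]; exact hx.2.trans hhi1
    rw [hact hx1 hx2, hG0 (x - e ⟨0, h0⟩) hx1 (by rw [sub_add_cancel]; exact hx), pull_apply]
  · -- the bound on every bond meeting `Λ^{(k)}`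
    intro b hb
    obtain ⟨x, hx, hxμ, hbeq⟩ := hbond hb
    rw [hbeq, hact hx hxμ, show Vt ⟨castSite x, b.dir⟩ = pull Vt x b.dir from rfl]
    exact hbound x b.dir hx hxμ

end Torus

/-! ## §8 THE KNIT TO THE CARRIER OF RECORD: every point of the variables ∩ the domain lies on the Λ-orbit of a relatively
small configuration in the gauge `G₀` ([LF-II] p. 359 l. 5–6 at [IV] (1.77)'s *«orbits of this group»*) -/

section Carrier

variable {P : Params} {k : ℕ} {G : Type*} [GaugeGroup G]

open T4AxialGaugeSmallField (castSite boxPlaqs)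
open B15DeterminingSets (bondsOf pts)
open B15Prop1Carrier (IsGaugeOn orbit gaugeAct_mem_orbit extSet mem_extSet_iff domReg mem_domReg_iff plaqsInside)
open GaugeField (gaugeAct)

/-- **[LF-II] p. 359 «Fixing the gauge G₀ for V′ we get a small configuration» ON THE Λ-ORBITS OF [IV] (1.77), group level.**
`d ≥ 2`; `Λ^{(k)} = castSite '' [lo, hi]` a box of the torus `T^{(k)}` with at most `n + 1` sites per direction whose one-layer
enlargement does not wrap; `Ṽ` a centre (print: the fixed extension of `V_k` of (1.75)) with `ε`-small plaquettes on the enlarged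
box; `W` a value of the variables at `Ṽ` (`W ∈ extSet (bondsOf Λ^{(k)}) Ṽ`: `W = Ṽ` off the bonds meeting `Λ^{(k)}`) with
`a`-small plaquettes there (print: *«mild regularity conditions»*, the domain of (1.77)).  THEN the Λ-orbit of `W`
(`B15Prop1Carrier.orbit`: gauge transformations equal to `1` off `Λ^{(k)}`) contains a configuration `U` which is again a value
of the variables at `Ṽ`, satisfies print's gauge condition `G₀` RELATIVE TO `Ṽ` — `U = Ṽ` on every `x₁`-bond `⟨x − e₁, x⟩`,
`x ∈ Λ` (p. 358) — and is CLOSE TO `Ṽ` on every bond meeting `Λ^{(k)}`: `dist1 (U(b) Ṽ(b)⁻¹) ≤ (n + 2)(n + d)(a + ε)`.  (The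
logarithm `U·Ṽ⁻¹ = exp iB′` and the size of `B′` are the chart's business — dictionary item (ℓ1) of `B15Prop1ChartDeviation`.)
[cite: Balaban1989LargeFieldII, pp.358–359 (proof of Proposition 1 [IV]); Balaban1989LargeFieldI, Prop. 1 (1.77) p.194] -/
theorem exists_mem_orbit_relSmall (hd : 2 ≤ P.d) {lo hi : Fin P.d → ℤ} {n : ℕ} (hn : ∀ κ, hi κ ≤ lo κ + n)
    (hN : n + 2 < P.sitesPerDir k) {Vt W : GaugeField P k G} {a ε : ℝ} (ha : 0 ≤ a) (hε : 0 ≤ ε)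
    (hWext : W ∈ extSet (bondsOf (castSite '' Icc lo hi : Set (Site P k))) Vt)
    (hW : PlaqSmallOn (boxPlaqs (lo - 1) (hi + 1)) a W) (hV : PlaqSmallOn (boxPlaqs (lo - 1) (hi + 1)) ε Vt) :
    ∃ U ∈ orbit (castSite '' Icc lo hi : Set (Site P k)) W,
      U ∈ extSet (bondsOf (castSite '' Icc lo hi : Set (Site P k))) Vt ∧
      (∀ μ : Fin P.d, (μ : ℕ) = 0 → ∀ x, x ∈ Icc lo hi → U ⟨castSite (x - e μ), μ⟩ = Vt ⟨castSite (x - e μ), μ⟩) ∧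
      ∀ b ∈ bondsOf (castSite '' Icc lo hi : Set (Site P k)),
        dist1 (U b * (Vt b)⁻¹) ≤ ((n : ℝ) + 2) * ((n : ℝ) + P.d) * (a + ε) := by
  obtain ⟨u, hu, h1, h2, h3⟩ :=
    exists_isGaugeOn_relSmall hd hn hN W Vt ha hε hW hV fun b hb => (mem_extSet_iff.1 hWext) b hb
  exact ⟨gaugeAct u W, gaugeAct_mem_orbit hu W, fun b hb => h1 b hb, h2, h3⟩

/-- The same with the regularity hypotheses in the carrier's words: the domain of (1.77) `domReg Z k a₁` (*«|∂V_k − 1| < a₁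
on Z»*, all plaquettes inside `Z^{(k)}`) and a centre regular inside `Z^{(k)}`, for a box `Λ` whose enlarged box has its
plaquettes inside `Z^{(k)}` (print: `Λ ⊂ Z`, [IV] p. 194). [cite: Balaban1989LargeFieldI, Prop. 1 (1.77) p.194;
Balaban1989LargeFieldII, pp.358–359 (proof of Proposition 1 [IV])] -/
theorem exists_mem_orbit_relSmall_of_domReg (hd : 2 ≤ P.d) {lo hi : Fin P.d → ℤ} {n : ℕ} (hn : ∀ κ, hi κ ≤ lo κ + n)
    (hN : n + 2 < P.sitesPerDir k) {Z : Set (Site P 0)}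
    (hZ : (boxPlaqs (lo - 1) (hi + 1) : Set (Plaq P k)) ⊆ plaqsInside (pts k Z))
    {Vt W : GaugeField P k G} {a₁ ε : ℝ} (ha₁ : 0 ≤ a₁) (hε : 0 ≤ ε)
    (hWext : W ∈ extSet (bondsOf (castSite '' Icc lo hi : Set (Site P k))) Vt) (hWdom : W ∈ domReg Z k a₁)
    (hVt : PlaqSmallOn (plaqsInside (pts k Z)) ε Vt) :
    ∃ U ∈ orbit (castSite '' Icc lo hi : Set (Site P k)) W,
      U ∈ extSet (bondsOf (castSite '' Icc lo hi : Set (Site P k))) Vt ∧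
      (∀ μ : Fin P.d, (μ : ℕ) = 0 → ∀ x, x ∈ Icc lo hi → U ⟨castSite (x - e μ), μ⟩ = Vt ⟨castSite (x - e μ), μ⟩) ∧
      ∀ b ∈ bondsOf (castSite '' Icc lo hi : Set (Site P k)),
        dist1 (U b * (Vt b)⁻¹) ≤ ((n : ℝ) + 2) * ((n : ℝ) + P.d) * (a₁ + ε) :=
  exists_mem_orbit_relSmall hd hn hN ha₁ hε hWext (fun p hp => (mem_domReg_iff.1 hWdom) p (hZ hp))
    fun p hp => hVt p (hZ hp)

end Carrier

end Literature.MathematicalPhysics.QuantumFieldTheory.Balaban1983to89.B15Prop1RelativeAxialGauge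

end
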